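import Summits.QuantumFields.BalabanUV.Beta.SecondOrderSplitLoc
import Summits.QuantumFields.BalabanUV.Beta.SecondOrderRemainderTables
import Summits.QuantumFields.BalabanUV.Beta.SpineRecursivePureParity
import Summits.QuantumFields.BalabanUV.Beta.SpineRecursiveW

/-!
# `BalabanUV.Beta.SecondOrderSplitLiteral` — binder row D1, (L4) W-side of hR, leaf (W-SPLIT-AN): **THE ANALYTIC BINDERS OF THE W-END AT
# THE LITERAL** — `hsplit` (with the letter-remainder slots), (hDg), (hX2L), (hΔL), (hΔ0) of
# `SpineRooted.axisReflectionCovariant_flipK_TbalOf_JsRecWAtOf_rem` as THEOREMS over the recursive W-literal v2.26 (β sub-cell, D1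
# formalisation swarm, unit `b2b-balaban-beta-d1-formalise-leaf-10`, gen 3; CLAIM «D1-hR-L4-SPLIT-AN», journal l.11634; LEAVES v10.1 row HR-W-SPLIT-AN)

NOT IN PRINT; OUR BOOKKEEPING.  HONEST FRAMING (cell charter, verbatim): «discharging `BetaPertH` makes Bałaban's UV stability
UNCONDITIONAL — a real constructive-QFT result; it is NOT the continuum limit and NOT the Clay problem.»  HONEST DEPENDENCY (verbatim):
«continuum YM on T⁴ ⇐ BetaPertH ∧ nine spine estimates (0/9 proved); BetaPertH ⇐ (D1) ∧ (D4) ∧ CAP+tail; G-an2-4 gates asym, D1 and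
NE2/3/4.»  [folklore] analysis bookkeeping over tree objects BY NAME; no statement of Bałaban's papers, no `[cite:]`, no `def`, no
`def … : Prop`; discharges no LETTER ((hT2-rem), (hM2)), no lock, no binder of the β-function wall by itself.  NOT D1, NOT `BetaPertH`,
NOT continuum, NOT Clay.

WHAT.  At the literal `K := G_j = coDressKBmAt ρ Lc (KInvStep Lc j)`, `𝕄 := bhKStepAt d ρ Lc j`, `S := SpureRecAt j`, `M := M1At j`,
`S₂ := T2RecAt j`, `M₂ := M2Of d Lc mixFF j`, contact symbol `g := γ_j·ctGen d α Lc`, letter symbol `h`, letter remainders `R2` (and `RM`)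
— in-block root `ρ = toSite r`, generic `d`, `Lc ≥ 1`, any `cE cVH cΛ γ cE₂ cB T`:
* §1 `W2OfK_add_R₂` (generic): a field–field remainder bi-table added to `S₂` contributes `+ vertex2OfK K N R₂ b c` (leaf-05-g5's
  `vertex2OfK_add_of_bdd`); `literal_common` (one common rate for `G_j`, `bhKStepAt j`, `SpureRecAt j`).
* §2 **`W2OfK_sharp_split_literal`** = the END's `hsplit` AS A THEOREM (leaf-10 g2's `SecondOrderSplitDecay.W2OfK_sharp_split_of_decay` with
  EVERY analytic binder discharged at the literal: `decays_coDressKBmAt_KInvStep`, `spr_bhKStepAt`, `locStencil_SpureRecAt`, `vertexFamily_M1At`,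
  `T2RecAt_loc`, `locStencilFM_M2Of`, `locStencil_diagK_smul_ctGen`) with the second symbol `X2s` and the residual
  **`Δ := dM (Ξ_j α ν y′) Lc (SpureRecAt j) (M1At j) μ y + vertex2OfK G_j Lc R2 μ y ν y′`** DISPLAYED; hypotheses left = the LETTER classes
  (`|h| ≤ Bh`, `R2 ∈ LocStencil₂`); `W2OfK_sharp_split_literal₂` = the same with a field–multiplier remainder `RM` as well
  (`Δ := dM Ξ … + (vertex2OfK G_j R2 b c + (mixOfK G_j RM b c + mixOfK G_j RM c b))`, leaf-05-g5's `W2OfK_add_slot₂`) for the owner's announced `_rem'`.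
* §3 **`loc_dM_sharp_literal`** = (hDg); **`loc_diagK_secondSymbol_literal`** = (hX2L) under the letter class
  `LocStencil₂ (fun κ u κ′ u′ ↦ diagK (h κ u κ′ u′))` (leaf-10 g2's `SecondOrderSplitLoc`).
* §4 **`loc_Delta_literal`** / **`tadpole_Delta_literal_eq_zero`** = (hΔL)/(hΔ0) for the displayed `Δ` (leaf-05-g5's `loc_residual`,
  `tadpole_residual_eq_zero`, `loc_vertex2OfK`, `tadpole_vertex2OfK_eq_zero` BY NAME; `R2` row-parity-odd for the tadpole), and the `₂` twins
  via `loc_slot₂_stepProp` / `tadpole_slot₂_stepProp_eq_zero`.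
NOT HERE: the END-side wiring `…_JsRecWAtOf_of_letters` (row owner an2), the letters, the pins.
Provenance: D1 formalisation swarm, leaf prover 10 (gen 3), 2026-08-20; no existing file touched.
-/

noncomputable section

open Finset
open scoped BigOperators
open Literature.MathematicalPhysics.QuantumFieldTheory
open Literature.MathematicalPhysics.QuantumFieldTheory.Balaban1983to89
open Literature.MathematicalPhysics.QuantumFieldTheory.Balaban1983to89.Beta
open ExpKernelCalculus (MKer Decays BiLoc VertexFamily VertexFamily₂ comp tadpole)
open KernelWard (bdd_of_biLoc)
open AffineAveraging (box toSite)
open OneStepResolventKernel (Fib LocStencil decays_mono)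
open OneStepKernelFamily (KInvStep colH vertexOfK)
open BalabanCompositeJets (LocStencil₂)
open BalabanStepW2 (M2Of locStencilFM_M2Of)
open SecondOrderResponse (vertexOfM dM K2OfK vertex2OfK mixOfK W2OfK LocStencilFM)
open Summit.QuantumFields.BalabanUV.Beta.TameKernelCalculus
open Summit.QuantumFields.BalabanUV.Beta.ChartConjugation (conjV conjW)
open Summit.QuantumFields.BalabanUV.Beta.BorderedHessian (diagK bhKStepAt ctGen spr_bhKStepAt sgnK)
open Summit.QuantumFields.BalabanUV.Beta.AxialDressingRooted (coDressKBmAt decays_coDressKBmAt_KInvStep)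
open Summit.QuantumFields.BalabanUV.Beta.BubbleParity (spr_of_decays trK_coDressKBmAt_KInvStep)
open Summit.QuantumFields.BalabanUV.Beta.SpineRooted (SpureRecAt M1At T2RecAt locStencil_SpureRecAt vertexFamily_M1At T2RecAt_loc)
open Summit.QuantumFields.BalabanUV.Beta.SecondOrderSplitDecay (W2OfK_sharp_split_of_decay)
open Summit.QuantumFields.BalabanUV.Beta.SecondOrderSplitLoc (loc_dM_sharp loc_diagK_secondSymbol)
open Summit.QuantumFields.BalabanUV.Beta.SecondOrderRemainderTables (vertex2OfK_add_of_bdd W2OfK_add_slot₂ abs_le_of_locStencil₂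
  abs_le_of_locStencilFM loc_vertex2OfK tadpole_vertex2OfK_eq_zero loc_slot₂_stepProp tadpole_slot₂_stepProp_eq_zero)
open Summit.QuantumFields.BalabanUV.Beta.SpineRecursivePureParity (decays_locStencil_common locStencil_diagK_smul_ctGen loc_residual
  tadpole_residual_eq_zero)

namespace Summit.QuantumFields.BalabanUV.Beta.SecondOrderSplitLiteral

variable {d : ℕ}

/-! ## §1 Generic: a remainder bi-table in the field–field slot -/

section Generic

variable {N : ℕ} {K : MKer (d + 1) (Fib d)}

/-- [folklore] **A FIELD–FIELD REMAINDER BI-TABLE CONTRIBUTES ADDITIVELY**: `W2OfK K N S M (S₂ + R₂) M₂ b c = W2OfK K N S M S₂ M₂ b c +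
vertex2OfK K N R₂ b c` (decaying `K`, bounded `S₂`, `R₂`; leaf-05-g5's `vertex2OfK_add_of_bdd`). -/
theorem W2OfK_add_R₂ (hK : ∃ δ C : ℝ, 0 < δ ∧ 0 ≤ C ∧ Decays K C δ) (S M : Fin (d + 1) → (Fin (d + 1) → ℤ) → MKer (d + 1) (Fib d))
    {S₂ R₂ : Fin (d + 1) → (Fin (d + 1) → ℤ) → Fin (d + 1) → (Fin (d + 1) → ℤ) → MKer (d + 1) (Fib d)}
    (M₂ : Fin (d + 1) → (Fin (d + 1) → ℤ) → Fin (d + 1) → (Fin (d + 1) → ℤ) → MKer (d + 1) (Fib d)) {B₂ C₂ : ℝ}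
    (hS₂ : ∀ κ u κ' u' x z a b, |S₂ κ u κ' u' x z a b| ≤ B₂) (hR₂ : ∀ κ u κ' u' x z a b, |R₂ κ u κ' u' x z a b| ≤ C₂)
    (μ : Fin (d + 1)) (y : Fin (d + 1) → ℤ) (ν : Fin (d + 1)) (y' : Fin (d + 1) → ℤ) :
    W2OfK K N S M (fun κ u κ' u' => S₂ κ u κ' u' + R₂ κ u κ' u') M₂ μ y ν y' = W2OfK K N S M S₂ M₂ μ y ν y' + vertex2OfK K N R₂ μ y ν y' := by
  simp only [SecondOrderResponse.W2OfK]
  rw [vertex2OfK_add_of_bdd hK hS₂ hR₂ μ y ν y']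
  abel

end Generic

/-! ## §2 The literal: common rates, and `hsplit` as a theorem -/

section Literal

variable {Lc : ℕ} [NeZero Lc]

/-- [folklore] ONE COMMON RATE for the step propagator `G_j`, the step Hessian `bhKStepAt j` and the unfolded first-order table `SpureRecAt j`
(leaf-05-g5's `decays_locStencil_common` + `spr_bhKStepAt`, rates shrunk to the minimum). -/
theorem literal_common (hLc : 1 ≤ Lc) {r : Fin (d + 1) → ℕ} (hr : r ∈ box (d + 1) Lc) (cE cVH cΛ : ℝ) (j : ℕ) :
    ∃ m C C𝕄 Cs : ℝ, 0 < m ∧ 0 ≤ C ∧ Decays (coDressKBmAt (toSite r) Lc (KInvStep (d := d) Lc j)) C m ∧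
      Decays (bhKStepAt d (toSite r) Lc j) C𝕄 m ∧ LocStencil (SpureRecAt d Lc (toSite r) cE cVH cΛ j) Cs m := by
  obtain ⟨m₀, C, Cs, hm₀, hC, hG, hS⟩ := decays_locStencil_common hLc hr cE cVH cΛ j
  obtain ⟨C𝕄, δ𝕄, hδ𝕄, h𝕄⟩ := spr_bhKStepAt (d := d) hr j
  exact ⟨min m₀ δ𝕄, C, |C𝕄|, |Cs|, lt_min hm₀ hδ𝕄, hC, decays_mono hG hC le_rfl (min_le_left _ _), decays_of_le h𝕄 (min_le_right _ _),
    fun κ u => biLoc_of_le (hS κ u) (min_le_left _ _)⟩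

/-- [folklore] **(hsplit) AS A THEOREM AT THE LITERAL** (field–field letter remainder `R2` only — the shape of
`SpineRooted.axisReflectionCovariant_flipK_TbalOf_JsRecWAtOf_rem`'s `hsplit` binder at fixed `(j, α)`, with the second symbol `X2s` and the
residual `Δ := dM (Ξ_j α ν y′) Lc (SpureRecAt j) (M1At j) μ y + vertex2OfK G_j Lc R2 μ y ν y′` DISPLAYED).  Hypotheses: the in-block root,
the border binder classes `hB`/`hmix` of the W-literal, a BOUNDED letter symbol `h` and a `LocStencil₂` letter remainder `R2` — nothing else. -/
theorem W2OfK_sharp_split_literal (hLc : 1 ≤ Lc) {r : Fin (d + 1) → ℕ} (hr : r ∈ box (d + 1) Lc) (cE cVH cΛ cE₂ cB : ℝ)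
    (T : Fin 4 → Fin 4 → Fin 4 → Fin 4 → ℝ)
    {vh₂S : Fin (d + 1) → (Fin (d + 1) → ℤ) → Fin (d + 1) → (Fin (d + 1) → ℤ) → MKer (d + 1) (Fib d)}
    (hB : ∃ C δ : ℝ, 0 < δ ∧ LocStencil₂ vh₂S C δ)
    {mixFF : Fin (d + 1) → (Fin (d + 1) → ℤ) → Fin (d + 1) → (Fin (d + 1) → ℤ) → MKer (d + 1) (Fib d)}
    (hmix : ∃ C δ : ℝ, 0 < δ ∧ LocStencilFM Lc mixFF C δ) (γ : ℕ → ℝ) (j : ℕ) (α : Fin (d + 1))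
    {h : Fin (d + 1) → (Fin (d + 1) → ℤ) → Fin (d + 1) → (Fin (d + 1) → ℤ) → (Fin (d + 1) → ℤ) → Fib d → ℝ} {Bh : ℝ}
    (hhb : ∀ κ u κ' u' p c, |h κ u κ' u' p c| ≤ Bh)
    {R2 : Fin (d + 1) → (Fin (d + 1) → ℤ) → Fin (d + 1) → (Fin (d + 1) → ℤ) → MKer (d + 1) (Fib d)}
    (hR2 : ∃ C δ : ℝ, 0 < δ ∧ LocStencil₂ R2 C δ)
    (μ : Fin (d + 1)) (y : Fin (d + 1) → ℤ) (ν : Fin (d + 1)) (y' : Fin (d + 1) → ℤ) :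
    W2OfK (coDressKBmAt (toSite r) Lc (KInvStep (d := d) Lc j)) Lc
        (fun κ u => SpureRecAt d Lc (toSite r) cE cVH cΛ j κ u +
          conjV (bhKStepAt d (toSite r) Lc j) (diagK fun p c => γ j * ctGen d α Lc κ u p c))
        (M1At d Lc (toSite r) cΛ j)
        (fun κ u κ' u' => T2RecAt d Lc (toSite r) cE cVH cΛ cE₂ cB T vh₂S mixFF j κ u κ' u' +
          conjW (bhKStepAt d (toSite r) Lc j) (SpureRecAt d Lc (toSite r) cE cVH cΛ j κ u) (SpureRecAt d Lc (toSite r) cE cVH cΛ j κ' u')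
            (diagK fun p c => γ j * ctGen d α Lc κ u p c) (diagK fun p c => γ j * ctGen d α Lc κ' u' p c) (diagK (h κ u κ' u')) +
          R2 κ u κ' u')
        (fun κ u ρ w => M2Of d Lc mixFF j κ u ρ w + conjV (M1At d Lc (toSite r) cΛ j ρ w) (diagK fun p c => γ j * ctGen d α Lc κ u p c))
        μ y ν y' =
      W2OfK (coDressKBmAt (toSite r) Lc (KInvStep (d := d) Lc j)) Lc (SpureRecAt d Lc (toSite r) cE cVH cΛ j) (M1At d Lc (toSite r) cΛ j)
          (T2RecAt d Lc (toSite r) cE cVH cΛ cE₂ cB T vh₂S mixFF j) (M2Of d Lc mixFF j) μ y ν y' +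
        conjW (bhKStepAt d (toSite r) Lc j)
          (dM (coDressKBmAt (toSite r) Lc (KInvStep (d := d) Lc j)) Lc (SpureRecAt d Lc (toSite r) cE cVH cΛ j) (M1At d Lc (toSite r) cΛ j) μ y)
          (dM (coDressKBmAt (toSite r) Lc (KInvStep (d := d) Lc j)) Lc (SpureRecAt d Lc (toSite r) cE cVH cΛ j) (M1At d Lc (toSite r) cΛ j) ν y')
          (diagK fun p c => ∑ κ, ∑' u, colH (coDressKBmAt (toSite r) Lc (KInvStep (d := d) Lc j)) Lc μ y κ u * (γ j * ctGen d α Lc κ u p c))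
          (diagK fun p c => ∑ κ', ∑' u', colH (coDressKBmAt (toSite r) Lc (KInvStep (d := d) Lc j)) Lc ν y' κ' u' * (γ j * ctGen d α Lc κ' u' p c))
          (diagK fun p c =>
            (∑ κ, ∑' u, colH (coDressKBmAt (toSite r) Lc (KInvStep (d := d) Lc j)) Lc μ y κ u *
                ∑ κ', ∑' u', colH (coDressKBmAt (toSite r) Lc (KInvStep (d := d) Lc j)) Lc ν y' κ' u' * h κ u κ' u' p c) +
              ∑ κ, ∑' u, colH (K2OfK (coDressKBmAt (toSite r) Lc (KInvStep (d := d) Lc j)) Lc (SpureRecAt d Lc (toSite r) cE cVH cΛ j)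
                  (M1At d Lc (toSite r) cΛ j) ν y' +
                -(comp (comp (coDressKBmAt (toSite r) Lc (KInvStep (d := d) Lc j))
                    (conjV (bhKStepAt d (toSite r) Lc j)
                      (diagK fun p c => ∑ κ, ∑' u, colH (coDressKBmAt (toSite r) Lc (KInvStep (d := d) Lc j)) Lc ν y' κ u * (γ j * ctGen d α Lc κ u p c))))
                    (coDressKBmAt (toSite r) Lc (KInvStep (d := d) Lc j)))) Lc μ y κ u * (γ j * ctGen d α Lc κ u p c)) +
        (dM (-(comp (comp (coDressKBmAt (toSite r) Lc (KInvStep (d := d) Lc j))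
              (conjV (bhKStepAt d (toSite r) Lc j)
                (diagK fun p c => ∑ κ, ∑' u, colH (coDressKBmAt (toSite r) Lc (KInvStep (d := d) Lc j)) Lc ν y' κ u * (γ j * ctGen d α Lc κ u p c))))
              (coDressKBmAt (toSite r) Lc (KInvStep (d := d) Lc j))))
            Lc (SpureRecAt d Lc (toSite r) cE cVH cΛ j) (M1At d Lc (toSite r) cΛ j) μ y +
          vertex2OfK (coDressKBmAt (toSite r) Lc (KInvStep (d := d) Lc j)) Lc R2 μ y ν y') := by
  obtain ⟨m, C, C𝕄, Cs, hm, hC, hG, -, hS⟩ := literal_common hLc hr cE cVH cΛ j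
  have hK : ∃ δ C : ℝ, 0 < δ ∧ 0 ≤ C ∧ Decays (coDressKBmAt (toSite r) Lc (KInvStep (d := d) Lc j)) C δ := ⟨m, C, hm, hC, hG⟩
  obtain ⟨B₂, δ₂, hδ₂, hT₂⟩ := T2RecAt_loc cE cVH cΛ cE₂ cB T vh₂S mixFF hLc hr hB hmix j
  obtain ⟨CM, δM, hδM, hMx⟩ := hmix
  obtain ⟨C₂, δR, hδR, hR₂⟩ := hR2
  have hB₂ : ∀ κ u κ' u' x z a b, |T2RecAt d Lc (toSite r) cE cVH cΛ cE₂ cB T vh₂S mixFF j κ u κ' u' x z a b| ≤ B₂ :=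
    fun κ u κ' u' x z a b => abs_le_of_locStencil₂ hT₂ hδ₂.le κ u κ' u' x z a b
  have hR₂b : ∀ κ u κ' u' x z a b, |R2 κ u κ' u' x z a b| ≤ C₂ := fun κ u κ' u' x z a b => abs_le_of_locStencil₂ hR₂ hδR.le κ u κ' u' x z a b
  have hBM : ∀ κ u ρ w x z a b, |M2Of d Lc mixFF j κ u ρ w x z a b| ≤ |BalabanStepW2.wM2 d Lc j| * CM :=
    fun κ u ρ w x z a b => abs_le_of_locStencilFM (locStencilFM_M2Of hMx j) hδM.le κ u ρ w x z a b
  have hB₂' : ∀ κ u κ' u' x z a b, |(T2RecAt d Lc (toSite r) cE cVH cΛ cE₂ cB T vh₂S mixFF j κ u κ' u' + R2 κ u κ' u') x z a b| ≤ B₂ + C₂ :=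
    fun κ u κ' u' x z a b => by
      rw [Pi.add_apply, Pi.add_apply, Pi.add_apply, Pi.add_apply]
      exact (abs_add_le _ _).trans (add_le_add (hB₂ κ u κ' u' x z a b) (hR₂b κ u κ' u' x z a b))
  -- regroup the remainder next to the plain bi-table
  rw [show (fun κ u κ' u' => T2RecAt d Lc (toSite r) cE cVH cΛ cE₂ cB T vh₂S mixFF j κ u κ' u' +
          conjW (bhKStepAt d (toSite r) Lc j) (SpureRecAt d Lc (toSite r) cE cVH cΛ j κ u) (SpureRecAt d Lc (toSite r) cE cVH cΛ j κ' u')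
            (diagK fun p c => γ j * ctGen d α Lc κ u p c) (diagK fun p c => γ j * ctGen d α Lc κ' u' p c) (diagK (h κ u κ' u')) +
          R2 κ u κ' u') =
        (fun κ u κ' u' => (T2RecAt d Lc (toSite r) cE cVH cΛ cE₂ cB T vh₂S mixFF j κ u κ' u' + R2 κ u κ' u') +
          conjW (bhKStepAt d (toSite r) Lc j) (SpureRecAt d Lc (toSite r) cE cVH cΛ j κ u) (SpureRecAt d Lc (toSite r) cE cVH cΛ j κ' u')
            (diagK fun p c => γ j * ctGen d α Lc κ u p c) (diagK fun p c => γ j * ctGen d α Lc κ' u' p c) (diagK (h κ u κ' u')))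
      from funext fun κ => funext fun u => funext fun κ' => funext fun u' => add_right_comm _ _ _]
  rw [W2OfK_sharp_split_of_decay (N := Lc) hG hC hm (spr_bhKStepAt hr j) hS (vertexFamily_M1At hLc hr cΛ j hm.le)
      (S₂ := fun κ u κ' u' => T2RecAt d Lc (toSite r) cE cVH cΛ cE₂ cB T vh₂S mixFF j κ u κ' u' + R2 κ u κ' u') hB₂' hBM
      (locStencil_diagK_smul_ctGen (Lc := Lc) (γ j) α hm.le) hhb μ y ν y',
    W2OfK_add_R₂ hK _ _ _ hB₂ hR₂b μ y ν y']
  abel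


/-- [folklore] **(hsplit) AT THE LITERAL WITH BOTH LETTER-REMAINDER SLOTS** (`R2` field–field, `RM` field–multiplier — the shape for the
owner's announced `…_JsRecWAtOf_rem'`): the residual is `Δ := dM (Ξ_j α ν y′) … μ y + (vertex2OfK G_j R2 b c + (mixOfK G_j RM b c + mixOfK G_j RM c b))`
(leaf-05-g5's `W2OfK_add_slot₂`). -/
theorem W2OfK_sharp_split_literal₂ (hLc : 1 ≤ Lc) {r : Fin (d + 1) → ℕ} (hr : r ∈ box (d + 1) Lc) (cE cVH cΛ cE₂ cB : ℝ)
    (T : Fin 4 → Fin 4 → Fin 4 → Fin 4 → ℝ)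
    {vh₂S : Fin (d + 1) → (Fin (d + 1) → ℤ) → Fin (d + 1) → (Fin (d + 1) → ℤ) → MKer (d + 1) (Fib d)}
    (hB : ∃ C δ : ℝ, 0 < δ ∧ LocStencil₂ vh₂S C δ)
    {mixFF : Fin (d + 1) → (Fin (d + 1) → ℤ) → Fin (d + 1) → (Fin (d + 1) → ℤ) → MKer (d + 1) (Fib d)}
    (hmix : ∃ C δ : ℝ, 0 < δ ∧ LocStencilFM Lc mixFF C δ) (γ : ℕ → ℝ) (j : ℕ) (α : Fin (d + 1))
    {h : Fin (d + 1) → (Fin (d + 1) → ℤ) → Fin (d + 1) → (Fin (d + 1) → ℤ) → (Fin (d + 1) → ℤ) → Fib d → ℝ} {Bh : ℝ}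
    (hhb : ∀ κ u κ' u' p c, |h κ u κ' u' p c| ≤ Bh)
    {R2 RM : Fin (d + 1) → (Fin (d + 1) → ℤ) → Fin (d + 1) → (Fin (d + 1) → ℤ) → MKer (d + 1) (Fib d)}
    (hR2 : ∃ C δ : ℝ, 0 < δ ∧ LocStencil₂ R2 C δ) (hRM : ∃ C δ : ℝ, 0 < δ ∧ LocStencilFM Lc RM C δ)
    (μ : Fin (d + 1)) (y : Fin (d + 1) → ℤ) (ν : Fin (d + 1)) (y' : Fin (d + 1) → ℤ) :
    W2OfK (coDressKBmAt (toSite r) Lc (KInvStep (d := d) Lc j)) Lc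
        (fun κ u => SpureRecAt d Lc (toSite r) cE cVH cΛ j κ u +
          conjV (bhKStepAt d (toSite r) Lc j) (diagK fun p c => γ j * ctGen d α Lc κ u p c))
        (M1At d Lc (toSite r) cΛ j)
        (fun κ u κ' u' => T2RecAt d Lc (toSite r) cE cVH cΛ cE₂ cB T vh₂S mixFF j κ u κ' u' +
          conjW (bhKStepAt d (toSite r) Lc j) (SpureRecAt d Lc (toSite r) cE cVH cΛ j κ u) (SpureRecAt d Lc (toSite r) cE cVH cΛ j κ' u')
            (diagK fun p c => γ j * ctGen d α Lc κ u p c) (diagK fun p c => γ j * ctGen d α Lc κ' u' p c) (diagK (h κ u κ' u')) +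
          R2 κ u κ' u')
        (fun κ u ρ w => M2Of d Lc mixFF j κ u ρ w + conjV (M1At d Lc (toSite r) cΛ j ρ w) (diagK fun p c => γ j * ctGen d α Lc κ u p c) +
          RM κ u ρ w)
        μ y ν y' =
      W2OfK (coDressKBmAt (toSite r) Lc (KInvStep (d := d) Lc j)) Lc (SpureRecAt d Lc (toSite r) cE cVH cΛ j) (M1At d Lc (toSite r) cΛ j)
          (T2RecAt d Lc (toSite r) cE cVH cΛ cE₂ cB T vh₂S mixFF j) (M2Of d Lc mixFF j) μ y ν y' +
        conjW (bhKStepAt d (toSite r) Lc j)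
          (dM (coDressKBmAt (toSite r) Lc (KInvStep (d := d) Lc j)) Lc (SpureRecAt d Lc (toSite r) cE cVH cΛ j) (M1At d Lc (toSite r) cΛ j) μ y)
          (dM (coDressKBmAt (toSite r) Lc (KInvStep (d := d) Lc j)) Lc (SpureRecAt d Lc (toSite r) cE cVH cΛ j) (M1At d Lc (toSite r) cΛ j) ν y')
          (diagK fun p c => ∑ κ, ∑' u, colH (coDressKBmAt (toSite r) Lc (KInvStep (d := d) Lc j)) Lc μ y κ u * (γ j * ctGen d α Lc κ u p c))
          (diagK fun p c => ∑ κ', ∑' u', colH (coDressKBmAt (toSite r) Lc (KInvStep (d := d) Lc j)) Lc ν y' κ' u' * (γ j * ctGen d α Lc κ' u' p c))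
          (diagK fun p c =>
            (∑ κ, ∑' u, colH (coDressKBmAt (toSite r) Lc (KInvStep (d := d) Lc j)) Lc μ y κ u *
                ∑ κ', ∑' u', colH (coDressKBmAt (toSite r) Lc (KInvStep (d := d) Lc j)) Lc ν y' κ' u' * h κ u κ' u' p c) +
              ∑ κ, ∑' u, colH (K2OfK (coDressKBmAt (toSite r) Lc (KInvStep (d := d) Lc j)) Lc (SpureRecAt d Lc (toSite r) cE cVH cΛ j)
                  (M1At d Lc (toSite r) cΛ j) ν y' +
                (-(comp (comp (coDressKBmAt (toSite r) Lc (KInvStep (d := d) Lc j))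
              (conjV (bhKStepAt d (toSite r) Lc j)
                (diagK fun p c => ∑ κ, ∑' u, colH (coDressKBmAt (toSite r) Lc (KInvStep (d := d) Lc j)) Lc ν y' κ u * (γ j * ctGen d α Lc κ u p c))))
              (coDressKBmAt (toSite r) Lc (KInvStep (d := d) Lc j))))) Lc μ y κ u * (γ j * ctGen d α Lc κ u p c)) +
        (dM (-(comp (comp (coDressKBmAt (toSite r) Lc (KInvStep (d := d) Lc j))
              (conjV (bhKStepAt d (toSite r) Lc j)
                (diagK fun p c => ∑ κ, ∑' u, colH (coDressKBmAt (toSite r) Lc (KInvStep (d := d) Lc j)) Lc ν y' κ u * (γ j * ctGen d α Lc κ u p c))))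
              (coDressKBmAt (toSite r) Lc (KInvStep (d := d) Lc j))))
            Lc (SpureRecAt d Lc (toSite r) cE cVH cΛ j) (M1At d Lc (toSite r) cΛ j) μ y +
          (vertex2OfK (coDressKBmAt (toSite r) Lc (KInvStep (d := d) Lc j)) Lc R2 μ y ν y' +
            (mixOfK (coDressKBmAt (toSite r) Lc (KInvStep (d := d) Lc j)) Lc RM μ y ν y' + mixOfK (coDressKBmAt (toSite r) Lc (KInvStep (d := d) Lc j)) Lc RM ν y' μ y))) := by
  obtain ⟨m, C, C𝕄, Cs, hm, hC, hG, -, hS⟩ := literal_common hLc hr cE cVH cΛ j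
  have hK : ∃ δ C : ℝ, 0 < δ ∧ 0 ≤ C ∧ Decays (coDressKBmAt (toSite r) Lc (KInvStep (d := d) Lc j)) C δ := ⟨m, C, hm, hC, hG⟩
  obtain ⟨B₂, δ₂, hδ₂, hT₂⟩ := T2RecAt_loc cE cVH cΛ cE₂ cB T vh₂S mixFF hLc hr hB hmix j
  obtain ⟨CM, δM, hδM, hMx⟩ := hmix
  obtain ⟨C₂, δR, hδR, hR₂⟩ := hR2
  obtain ⟨CR, δRM, hδRM, hRMl⟩ := hRM
  have hB₂ : ∀ κ u κ' u' x z a b, |T2RecAt d Lc (toSite r) cE cVH cΛ cE₂ cB T vh₂S mixFF j κ u κ' u' x z a b| ≤ B₂ :=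
    fun κ u κ' u' x z a b => abs_le_of_locStencil₂ hT₂ hδ₂.le κ u κ' u' x z a b
  have hR₂b : ∀ κ u κ' u' x z a b, |R2 κ u κ' u' x z a b| ≤ C₂ := fun κ u κ' u' x z a b => abs_le_of_locStencil₂ hR₂ hδR.le κ u κ' u' x z a b
  have hBM : ∀ κ u ρ w x z a b, |M2Of d Lc mixFF j κ u ρ w x z a b| ≤ |BalabanStepW2.wM2 d Lc j| * CM :=
    fun κ u ρ w x z a b => abs_le_of_locStencilFM (locStencilFM_M2Of hMx j) hδM.le κ u ρ w x z a b
  have hRMb : ∀ κ u ρ w x z a b, |RM κ u ρ w x z a b| ≤ CR := fun κ u ρ w x z a b => abs_le_of_locStencilFM hRMl hδRM.le κ u ρ w x z a b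
  have hB₂' : ∀ κ u κ' u' x z a b, |(T2RecAt d Lc (toSite r) cE cVH cΛ cE₂ cB T vh₂S mixFF j κ u κ' u' + R2 κ u κ' u') x z a b| ≤ B₂ + C₂ :=
    fun κ u κ' u' x z a b => by
      rw [Pi.add_apply, Pi.add_apply, Pi.add_apply, Pi.add_apply]
      exact (abs_add_le _ _).trans (add_le_add (hB₂ κ u κ' u' x z a b) (hR₂b κ u κ' u' x z a b))
  have hBM' : ∀ κ u ρ w x z a b, |(M2Of d Lc mixFF j κ u ρ w + RM κ u ρ w) x z a b| ≤ |BalabanStepW2.wM2 d Lc j| * CM + CR :=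
    fun κ u ρ w x z a b => by
      rw [Pi.add_apply, Pi.add_apply, Pi.add_apply, Pi.add_apply]
      exact (abs_add_le _ _).trans (add_le_add (hBM κ u ρ w x z a b) (hRMb κ u ρ w x z a b))
  -- regroup both remainders next to the plain tables
  rw [show (fun κ u κ' u' => T2RecAt d Lc (toSite r) cE cVH cΛ cE₂ cB T vh₂S mixFF j κ u κ' u' +
          conjW (bhKStepAt d (toSite r) Lc j) (SpureRecAt d Lc (toSite r) cE cVH cΛ j κ u) (SpureRecAt d Lc (toSite r) cE cVH cΛ j κ' u')
            (diagK fun p c => γ j * ctGen d α Lc κ u p c) (diagK fun p c => γ j * ctGen d α Lc κ' u' p c) (diagK (h κ u κ' u')) +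
          R2 κ u κ' u') =
        (fun κ u κ' u' => (T2RecAt d Lc (toSite r) cE cVH cΛ cE₂ cB T vh₂S mixFF j κ u κ' u' + R2 κ u κ' u') +
          conjW (bhKStepAt d (toSite r) Lc j) (SpureRecAt d Lc (toSite r) cE cVH cΛ j κ u) (SpureRecAt d Lc (toSite r) cE cVH cΛ j κ' u')
            (diagK fun p c => γ j * ctGen d α Lc κ u p c) (diagK fun p c => γ j * ctGen d α Lc κ' u' p c) (diagK (h κ u κ' u')))
      from funext fun κ => funext fun u => funext fun κ' => funext fun u' => add_right_comm _ _ _,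
    show (fun κ u ρ w => M2Of d Lc mixFF j κ u ρ w + conjV (M1At d Lc (toSite r) cΛ j ρ w) (diagK fun p c => γ j * ctGen d α Lc κ u p c) +
          RM κ u ρ w) =
        (fun κ u ρ w => (M2Of d Lc mixFF j κ u ρ w + RM κ u ρ w) +
          conjV (M1At d Lc (toSite r) cΛ j ρ w) (diagK fun p c => γ j * ctGen d α Lc κ u p c))
      from funext fun κ => funext fun u => funext fun ρ => funext fun w => add_right_comm _ _ _]
  rw [W2OfK_sharp_split_of_decay (N := Lc) hG hC hm (spr_bhKStepAt hr j) hS (vertexFamily_M1At hLc hr cΛ j hm.le)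
      (S₂ := fun κ u κ' u' => T2RecAt d Lc (toSite r) cE cVH cΛ cE₂ cB T vh₂S mixFF j κ u κ' u' + R2 κ u κ' u')
      (M₂ := fun κ u ρ w => M2Of d Lc mixFF j κ u ρ w + RM κ u ρ w) hB₂' hBM'
      (locStencil_diagK_smul_ctGen (Lc := Lc) (γ j) α hm.le) hhb μ y ν y',
    W2OfK_add_slot₂ hK _ _ hB₂ hR₂b hBM hRMb μ y ν y']
  abel

end Literal

/-! ## §3 (hDg) and (hX2L) at the literal -/

section Loc

variable {Lc : ℕ} [NeZero Lc]

/-- [folklore] **(hDg) AT THE LITERAL**: `Loc (dM G_j Lc S♯ (M1At j) ν y′)` for the ♯-table `S♯ κ u = SpureRecAt j κ u + conjV (bhKStepAt j) (diagK (γ_j·ctGen d α Lc κ u))`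
— every level `j`, axis `α`, bond `(ν, y′)`, any `γ` (leaf-10 g2's `SecondOrderSplitLoc.loc_dM_sharp` at one common rate). -/
theorem loc_dM_sharp_literal (hLc : 1 ≤ Lc) {r : Fin (d + 1) → ℕ} (hr : r ∈ box (d + 1) Lc) (cE cVH cΛ : ℝ) (γ : ℕ → ℝ) (j : ℕ)
    (α ν : Fin (d + 1)) (y' : Fin (d + 1) → ℤ) :
    Loc (dM (coDressKBmAt (toSite r) Lc (KInvStep (d := d) Lc j)) Lc
      (fun κ u => SpureRecAt d Lc (toSite r) cE cVH cΛ j κ u +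
        conjV (bhKStepAt d (toSite r) Lc j) (diagK fun p c => γ j * ctGen d α Lc κ u p c))
      (M1At d Lc (toSite r) cΛ j) ν y') := by
  obtain ⟨m, C, C𝕄, Cs, hm, hC, hG, h𝕄, hS⟩ := literal_common hLc hr cE cVH cΛ j
  exact loc_dM_sharp (N := Lc) hG hC h𝕄 hm hS (vertexFamily_M1At hLc hr cΛ j hm.le) (locStencil_diagK_smul_ctGen (Lc := Lc) (γ j) α hm.le) ν y'

/-- [folklore] **(hX2L) AT THE LITERAL**: the displayed second symbol `X2s` of `W2OfK_sharp_split_literal` is localised once the LETTER symbol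
`h` carries the class `LocStencil₂ (fun κ u κ′ u′ ↦ diagK (h κ u κ′ u′))` at SOME positive rate (leaf-10 g2's `loc_diagK_secondSymbol`;
typer XREAD FINDING-INFO on p215091: this is the h-class the letters must deliver). -/
theorem loc_diagK_secondSymbol_literal (hLc : 1 ≤ Lc) {r : Fin (d + 1) → ℕ} (hr : r ∈ box (d + 1) Lc) (cE cVH cΛ : ℝ) (γ : ℕ → ℝ) (j : ℕ)
    (α : Fin (d + 1)) {h : Fin (d + 1) → (Fin (d + 1) → ℤ) → Fin (d + 1) → (Fin (d + 1) → ℤ) → (Fin (d + 1) → ℤ) → Fib d → ℝ}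
    (hhl : ∃ Ch mh : ℝ, 0 < mh ∧ LocStencil₂ (fun κ u κ' u' => diagK (h κ u κ' u')) Ch mh)
    (μ : Fin (d + 1)) (y : Fin (d + 1) → ℤ) (ν : Fin (d + 1)) (y' : Fin (d + 1) → ℤ) :
    Loc (diagK fun p c =>
      (∑ κ, ∑' u, colH (coDressKBmAt (toSite r) Lc (KInvStep (d := d) Lc j)) Lc μ y κ u *
          ∑ κ', ∑' u', colH (coDressKBmAt (toSite r) Lc (KInvStep (d := d) Lc j)) Lc ν y' κ' u' * h κ u κ' u' p c) +
        ∑ κ, ∑' u, colH (K2OfK (coDressKBmAt (toSite r) Lc (KInvStep (d := d) Lc j)) Lc (SpureRecAt d Lc (toSite r) cE cVH cΛ j)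
            (M1At d Lc (toSite r) cΛ j) ν y' +
          (-(comp (comp (coDressKBmAt (toSite r) Lc (KInvStep (d := d) Lc j))
              (conjV (bhKStepAt d (toSite r) Lc j)
                (diagK fun p c => ∑ κ, ∑' u, colH (coDressKBmAt (toSite r) Lc (KInvStep (d := d) Lc j)) Lc ν y' κ u * (γ j * ctGen d α Lc κ u p c))))
              (coDressKBmAt (toSite r) Lc (KInvStep (d := d) Lc j))))) Lc μ y κ u * (γ j * ctGen d α Lc κ u p c)) := by
  obtain ⟨m, C, C𝕄, Cs, hm, hC, hG, -, hS⟩ := literal_common hLc hr cE cVH cΛ j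
  obtain ⟨Ch, mh, hmh, hh⟩ := hhl
  have hm' : 0 < min m mh := lt_min hm hmh
  exact loc_diagK_secondSymbol (N := Lc) (decays_mono hG hC le_rfl (min_le_left _ _)) hC hm' (spr_bhKStepAt hr j)
    (Cs := |Cs|) (fun κ u => biLoc_of_le (hS κ u) (min_le_left _ _)) (vertexFamily_M1At hLc hr cΛ j hm'.le)
    (locStencil_diagK_smul_ctGen (Lc := Lc) (γ j) α hm'.le) (hh.mono (min_le_right _ _)) μ y ν y'

end Loc

/-! ## §4 (hΔL) and (hΔ0) for the displayed residual -/

section Delta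

variable {Lc : ℕ} [NeZero Lc]

/-- [folklore] **(hΔL) FOR THE DISPLAYED RESIDUAL** `Δ = dM (Ξ_j α ν y′) Lc (SpureRecAt j) (M1At j) μ y + vertex2OfK G_j Lc R2 μ y ν y′`
(leaf-05-g5's `loc_residual` + `loc_vertex2OfK`; `R2 ∈ LocStencil₂` at some rate). -/
theorem loc_Delta_literal (hLc : 1 ≤ Lc) {r : Fin (d + 1) → ℕ} (hr : r ∈ box (d + 1) Lc) (cE cVH cΛ : ℝ) (γ : ℕ → ℝ) (j : ℕ) (α : Fin (d + 1))
    {R2 : Fin (d + 1) → (Fin (d + 1) → ℤ) → Fin (d + 1) → (Fin (d + 1) → ℤ) → MKer (d + 1) (Fib d)} (hR2 : ∃ C δ : ℝ, 0 < δ ∧ LocStencil₂ R2 C δ)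
    (μ : Fin (d + 1)) (y : Fin (d + 1) → ℤ) (ν : Fin (d + 1)) (y' : Fin (d + 1) → ℤ) :
    Loc (dM (-(comp (comp (coDressKBmAt (toSite r) Lc (KInvStep (d := d) Lc j))
              (conjV (bhKStepAt d (toSite r) Lc j)
                (diagK fun p c => ∑ κ, ∑' u, colH (coDressKBmAt (toSite r) Lc (KInvStep (d := d) Lc j)) Lc ν y' κ u * (γ j * ctGen d α Lc κ u p c))))
              (coDressKBmAt (toSite r) Lc (KInvStep (d := d) Lc j))))
        Lc (SpureRecAt d Lc (toSite r) cE cVH cΛ j) (M1At d Lc (toSite r) cΛ j) μ y +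
      vertex2OfK (coDressKBmAt (toSite r) Lc (KInvStep (d := d) Lc j)) Lc R2 μ y ν y') := by
  obtain ⟨δG, C, hδG, hC, hG⟩ := decays_coDressKBmAt_KInvStep (d := d) hr j
  obtain ⟨C₂, δR, hδR, hR₂⟩ := hR2
  exact (loc_residual hLc hr cE cVH cΛ γ j α μ y ν y').add
    (loc_vertex2OfK (N := Lc) (decays_mono hG hC le_rfl (min_le_left δG δR)) hC (lt_min hδG hδR) (hR₂.mono (min_le_right δG δR)) μ y ν y')

/-- [folklore] **(hΔ0) FOR THE DISPLAYED RESIDUAL — ZERO TADPOLE AGAINST `G_j`**: `tadpole G_j Δ = 0` for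
`Δ = dM (Ξ_j α ν y′) … μ y + vertex2OfK G_j Lc R2 μ y ν y′` with a ROW-PARITY-ODD local `R2` (leaf-05-g5's `tadpole_residual_eq_zero` +
`tadpole_vertex2OfK_eq_zero`, `tadpole_add`). -/
theorem tadpole_Delta_literal_eq_zero (hLc : 1 ≤ Lc) {r : Fin (d + 1) → ℕ} (hr : r ∈ box (d + 1) Lc) (cE cVH cΛ : ℝ) (γ : ℕ → ℝ) (j : ℕ)
    (α : Fin (d + 1)) {R2 : Fin (d + 1) → (Fin (d + 1) → ℤ) → Fin (d + 1) → (Fin (d + 1) → ℤ) → MKer (d + 1) (Fib d)}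
    (hR2 : ∃ C δ : ℝ, 0 < δ ∧ LocStencil₂ R2 C δ) (hR2p : ∀ κ u κ' u', trK (R2 κ u κ' u') = -sgnK (R2 κ u κ' u'))
    (μ : Fin (d + 1)) (y : Fin (d + 1) → ℤ) (ν : Fin (d + 1)) (y' : Fin (d + 1) → ℤ) :
    tadpole (coDressKBmAt (toSite r) Lc (KInvStep (d := d) Lc j))
      (dM (-(comp (comp (coDressKBmAt (toSite r) Lc (KInvStep (d := d) Lc j))
              (conjV (bhKStepAt d (toSite r) Lc j)
                (diagK fun p c => ∑ κ, ∑' u, colH (coDressKBmAt (toSite r) Lc (KInvStep (d := d) Lc j)) Lc ν y' κ u * (γ j * ctGen d α Lc κ u p c))))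
              (coDressKBmAt (toSite r) Lc (KInvStep (d := d) Lc j))))
          Lc (SpureRecAt d Lc (toSite r) cE cVH cΛ j) (M1At d Lc (toSite r) cΛ j) μ y +
        vertex2OfK (coDressKBmAt (toSite r) Lc (KInvStep (d := d) Lc j)) Lc R2 μ y ν y') = 0 := by
  obtain ⟨δG, C, hδG, hC, hG⟩ := decays_coDressKBmAt_KInvStep (d := d) hr j
  obtain ⟨C₂, δR, hδR, hR₂⟩ := hR2
  have hG' := decays_mono hG hC le_rfl (min_le_left δG δR)
  have hm := lt_min hδG hδR
  have hGs : Spr (coDressKBmAt (toSite r) Lc (KInvStep (d := d) Lc j)) := spr_of_decays ⟨δG, C, hδG, hC, hG⟩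
  rw [tadpole_add hGs (loc_residual hLc hr cE cVH cΛ γ j α μ y ν y') (loc_vertex2OfK (N := Lc) hG' hC hm (hR₂.mono (min_le_right δG δR)) μ y ν y'),
    tadpole_residual_eq_zero hLc hr cE cVH cΛ γ j α μ y ν y',
    tadpole_vertex2OfK_eq_zero hGs (trK_coDressKBmAt_KInvStep hr j) hG' hC hm (hR₂.mono (min_le_right δG δR)) hR2p μ y ν y', add_zero]

/-- [folklore] **(hΔL) FOR THE TWO-SLOT RESIDUAL** of `W2OfK_sharp_split_literal₂` (leaf-05-g5's `loc_residual` + `loc_slot₂_stepProp`). -/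
theorem loc_Delta_literal₂ (hLc : 1 ≤ Lc) {r : Fin (d + 1) → ℕ} (hr : r ∈ box (d + 1) Lc) (cE cVH cΛ : ℝ) (γ : ℕ → ℝ) (j : ℕ) (α : Fin (d + 1))
    {R2 RM : Fin (d + 1) → (Fin (d + 1) → ℤ) → Fin (d + 1) → (Fin (d + 1) → ℤ) → MKer (d + 1) (Fib d)}
    (hR2 : ∃ C δ : ℝ, 0 < δ ∧ LocStencil₂ R2 C δ) (hRM : ∃ C δ : ℝ, 0 < δ ∧ LocStencilFM Lc RM C δ)
    (μ : Fin (d + 1)) (y : Fin (d + 1) → ℤ) (ν : Fin (d + 1)) (y' : Fin (d + 1) → ℤ) :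
    Loc (dM (-(comp (comp (coDressKBmAt (toSite r) Lc (KInvStep (d := d) Lc j))
              (conjV (bhKStepAt d (toSite r) Lc j)
                (diagK fun p c => ∑ κ, ∑' u, colH (coDressKBmAt (toSite r) Lc (KInvStep (d := d) Lc j)) Lc ν y' κ u * (γ j * ctGen d α Lc κ u p c))))
              (coDressKBmAt (toSite r) Lc (KInvStep (d := d) Lc j))))
        Lc (SpureRecAt d Lc (toSite r) cE cVH cΛ j) (M1At d Lc (toSite r) cΛ j) μ y +
      (vertex2OfK (coDressKBmAt (toSite r) Lc (KInvStep (d := d) Lc j)) Lc R2 μ y ν y' +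
        (mixOfK (coDressKBmAt (toSite r) Lc (KInvStep (d := d) Lc j)) Lc RM μ y ν y' + mixOfK (coDressKBmAt (toSite r) Lc (KInvStep (d := d) Lc j)) Lc RM ν y' μ y))) :=
  (loc_residual hLc hr cE cVH cΛ γ j α μ y ν y').add (loc_slot₂_stepProp hr j hR2 hRM μ y ν y')

/-- [folklore] **(hΔ0) FOR THE TWO-SLOT RESIDUAL** (row-parity-odd local `R2`, `RM`; leaf-05-g5's `tadpole_residual_eq_zero` +
`tadpole_slot₂_stepProp_eq_zero`). -/
theorem tadpole_Delta_literal₂_eq_zero (hLc : 1 ≤ Lc) {r : Fin (d + 1) → ℕ} (hr : r ∈ box (d + 1) Lc) (cE cVH cΛ : ℝ) (γ : ℕ → ℝ) (j : ℕ)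
    (α : Fin (d + 1)) {R2 RM : Fin (d + 1) → (Fin (d + 1) → ℤ) → Fin (d + 1) → (Fin (d + 1) → ℤ) → MKer (d + 1) (Fib d)}
    (hR2 : ∃ C δ : ℝ, 0 < δ ∧ LocStencil₂ R2 C δ) (hR2p : ∀ κ u κ' u', trK (R2 κ u κ' u') = -sgnK (R2 κ u κ' u'))
    (hRM : ∃ C δ : ℝ, 0 < δ ∧ LocStencilFM Lc RM C δ) (hRMp : ∀ κ u ρ w, trK (RM κ u ρ w) = -sgnK (RM κ u ρ w))
    (μ : Fin (d + 1)) (y : Fin (d + 1) → ℤ) (ν : Fin (d + 1)) (y' : Fin (d + 1) → ℤ) :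
    tadpole (coDressKBmAt (toSite r) Lc (KInvStep (d := d) Lc j))
      (dM (-(comp (comp (coDressKBmAt (toSite r) Lc (KInvStep (d := d) Lc j))
              (conjV (bhKStepAt d (toSite r) Lc j)
                (diagK fun p c => ∑ κ, ∑' u, colH (coDressKBmAt (toSite r) Lc (KInvStep (d := d) Lc j)) Lc ν y' κ u * (γ j * ctGen d α Lc κ u p c))))
              (coDressKBmAt (toSite r) Lc (KInvStep (d := d) Lc j))))
          Lc (SpureRecAt d Lc (toSite r) cE cVH cΛ j) (M1At d Lc (toSite r) cΛ j) μ y +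
        (vertex2OfK (coDressKBmAt (toSite r) Lc (KInvStep (d := d) Lc j)) Lc R2 μ y ν y' +
          (mixOfK (coDressKBmAt (toSite r) Lc (KInvStep (d := d) Lc j)) Lc RM μ y ν y' + mixOfK (coDressKBmAt (toSite r) Lc (KInvStep (d := d) Lc j)) Lc RM ν y' μ y))) = 0 := by
  rw [tadpole_add (spr_of_decays (decays_coDressKBmAt_KInvStep hr j)) (loc_residual hLc hr cE cVH cΛ γ j α μ y ν y')
      (loc_slot₂_stepProp hr j hR2 hRM μ y ν y'),
    tadpole_residual_eq_zero hLc hr cE cVH cΛ γ j α μ y ν y', tadpole_slot₂_stepProp_eq_zero hr j j hR2 hR2p hRM hRMp μ y ν y', add_zero]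

end Delta

end Summit.QuantumFields.BalabanUV.Beta.SecondOrderSplitLiteral

end
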